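import Literature.MathematicalPhysics.QuantumFieldTheory.Balaban1983to89.B9Eq3126EnergyBallTowerPiTwoBackgrounds
import Literature.MathematicalPhysics.QuantumFieldTheory.Balaban1983to89.B11Eq117LetterDefectsTwoBackgrounds

/-!
# `Balaban1983to89.B11Eq117LetterDefectsTowerPiTwoBackgrounds` — T. Bałaban, *The variational problem and background fields in renormalization group method
# for lattice gauge theories*, Commun. Math. Phys. **102** (1985) 277–309 [Balaban1985Variational] (117) p. 296, (115) p. 295, (174) p. 308, with T. Bałaban,
# *Propagators …*, CMP **99** (1985) [Balaban1985BackgroundPropagators] (3.122) p. 420, Thm 3.4 p. 400: **THE `k`-LEVEL (117) LETTER DEFECTS `K_ι`, `δ_G`, `δ_A`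
# BETWEEN TWO SMALL BACKGROUNDS AT PRINT's OPERATOR (3.122) — the chart's letters `𝔊̃_k`, `H̃_k` read in the norms (115) are Lipschitz in the background to first
# order** — the π twin ((T4)-6) of this lineage's gen-78 `B11Eq117LetterDefectsTowerTwoBackgrounds` (the same defects at the chain's `G₀`-slot letters), VERBATIM its
# text with the energy-ball junction swapped for `B9Eq3126EnergyBallTowerPiTwoBackgrounds`

statement-level skeleton of published theorems with citation tags; proofs where landed; nothing here is a claim about the Yang–Mills mass gap

PDF held: `paper:balaban1985-cmp102-variational-background` pp. 295–296, 308; `paper:balaban1985-cmp99-background-propagators` pp. 400, 420 — through the suppliers'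
quotations (the gen-78 file and the OWNER's `B11Eq117LetterDefects(TwoBackgrounds)` carry the verbatim lines of (115) ∕ (117)).

CITATION HEADER (lean-in-tree rule 2026-08-18).  Audit cell `pub-balaban`, sub-cell `t4`, NE9 crux team (2): LEAF PROVER 04 (`b2b-balaban-t4-ne9-formalise-leaf-04`
gen 79), INTENT-9 = (T4)-6 (the row OWNER t4-ne9-p1's GO `CLAIMS.log` l.53352 W-9 (α)).  WHY: the chart (174) between two coupling histories at PRINT's operator
(the last π twin, of gen-78 `B11Eq174ChartContinuityTowerTwoBackgrounds`) consumes exactly these three defects, as its `G₀`-slot original consumes the gen-78 file.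

WHAT IS PROVED (sorry-free; 0 `def`; [folklore] composition BY NAME; nothing of [B9] ∕ [B11] asserted as printed).
* **`exists_letter_defects_tower_pi_two_backgrounds_closed`** — the gen-78 statement with the positivity witnesses `hposU`, `hposV` now of `laplaceAkPi` at `U`, `V`
  (plus ANY `hpos′_U`, `hpos′_V` defining `G′_k`): `∃ α₀ δ₀ C > 0` FIRST; then (K_ι) the jet identity `∇_U → ∇_V` bound, (δ_G) the `𝔊̃`-letter defect and (δ_A) the
  `H̃₁`-letter defect across the two (115) norms, each `≤ (displayed (117) product) · δ · ‖·‖` — the products are the gen-78 ones (load-bearing finite-lattice numbers,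
  level AND volume; NOT print's lattice-uniform `B₀`).  MECHANISM: `exists_energy_ball_pi_two_backgrounds_closed` ([𝔊], [H] mass rows) fed to the OWNER's abstract
  (117) letters `B11Eq117LetterDefectsTwoBackgrounds.norm_nabla115_sub_le`, `B11Eq117LetterDefects.norm_toCLM115_readFun_sub_le` ∕ `norm_H1CLM_sub_le` exactly as in
  the gen-78 file.
MODEL ∕ DECLARED READINGS ∕ HONEST SCOPE.  Those of the gen-78 file and of (T4)-5: every window ∕ profile ∕ closeness letter, E162's data, unitarity + trace letters,
`ρ_w`, the witnesses are HYPOTHESES; the (117) products are finite-lattice numbers; FIRST order between two small backgrounds; no decay, no kernel bound, NOT the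
(N)-reading.  NOT summit progress (cell pub-balaban: NE9 NOT PRINTED ∕ NOT PROVED; «NE9 ⇐ the named binders»; row WALLED ON A MODEL (O-NE9-1; #5 UNRULED); spine
PROVED 0∕9; rung (B)+1 finite T⁴ — NOT infinite volume, NOT mass gap, NOT BetaPertH, NOT Clay).  HONEST DEPENDENCY (cell line): continuum YM on T⁴ ⇐ BetaPertH ∧
nine spine estimates (0/9 proved); BetaPertH ⇐ (D1) ∧ (D4) ∧ CAP+tail; G-an2-4 gates asym, D1 and NE2/3/4.  NEW file; nothing modified.  Net new unproved facts: 0.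
-/

noncomputable section

open scoped InnerProductSpace ComplexConjugate BigOperators

namespace Literature.MathematicalPhysics.QuantumFieldTheory.Balaban1983to89.B11Eq117LetterDefectsTowerPiTwoBackgrounds

open B4Sect5Torus (TSite)
open B9SectCLatticeCarrier (Bond)
open B11Eq103H1Complex (SiteL2K BondL2K covDerivL2K covDivL2K G1LatticeK H1LatticeK frakGLatticeK KinvLatticeK H1LatticeCLM frakGLatticeCLM H1CLM
  readFun)
open B11Eq115Space (NegSize Space115 levWeight NegSup)
open B11Eq111FrakG (nabla115 jetLinearEquiv toCLM115)
open B11Eq117TransformationNorm (norm_nabla115_le)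
open B11Eq117LetterDefects (norm_jetId_le norm_toCLM115_readFun_sub_le norm_H1CLM_sub_le jetId_frakG_eq_toCLM115_readFun frakG_eq_toCLM115_readFun)
open B11Eq117LetterDefectsTwoBackgrounds (norm_nabla115_sub_le)
open B9Eq310HessianOperator (adTransportW covCurlL2K)
open B9Eq310DeltaPrime (plaqHolU)
open B9Eq315QTorus (perCfg cornerSite)
open B9Eq315QTower (towerP UlevOf)
open B9Eq326OperatorTower (QkW RofUk)
open B9Eq324DeltaPrimeATower (laplacePrimeAk)
open B9Eq3119DeltaPiTower (laplaceAkPi)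
open B7Prop1Explicit (U1 Wcx boxVec)
open B9Eq3126EnergyBallTowerPiTwoBackgrounds (exists_energy_ball_pi_two_backgrounds_closed)

variable {d : ℕ} (hd : 1 ≤ d) (L : ℕ) [NeZero L] (hL : 1 ≤ L)
  {𝔸 : Type*} [NormedRing 𝔸] [NormedAlgebra ℂ 𝔸] [CompleteSpace 𝔸] [NormOneClass 𝔸] [StarRing 𝔸] [NormedStarGroup 𝔸] [StarModule ℂ 𝔸]
  [FiniteDimensional ℂ 𝔸]
  {W : Type*} [NormedAddCommGroup W] [InnerProductSpace ℂ W] [FiniteDimensional ℂ W] (φ : W ≃ₗ[ℂ] 𝔸)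
  {Mφ Mφ' : ℝ} (hMφ : 0 ≤ Mφ) (hMφ' : 0 ≤ Mφ') (hφ : ∀ w, ‖φ w‖ ≤ Mφ * ‖w‖) (hφ' : ∀ X, ‖φ.symm X‖ ≤ Mφ' * ‖X‖)
  {a : ℝ} (ha : 0 < a) {a' : ℝ} (ha' : 0 < a') {r : ℝ} (hr0 : 0 ≤ r) (hr1 : r < 1)
  (τ : 𝔸 →ₗ[ℂ] ℂ) {Cτ : ℝ} (hτ : ∀ X, ‖τ X‖ ≤ Cτ * ‖X‖) (hCτ : 0 ≤ Cτ) {ρw : ℝ} (hρw : 0 ≤ ρw)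
  (hτ₁ : ∀ X : 𝔸, τ (star X) = conj (τ X)) (hτ₂ : ∀ X Y : 𝔸, τ (X * Y) = τ (Y * X))
  (hφτ : ∀ X Y : 𝔸, ⟪φ.symm X, φ.symm Y⟫_ℂ = τ (star X * Y))

include hd hMφ hMφ' hφ hφ' ha ha' hr0 hr1 hτ hCτ hρw hτ₁ hτ₂ hφτ

set_option maxHeartbeats 800000 in
set_option maxRecDepth 8192 in
/-- **THE `k`-LEVEL LETTER DEFECTS BETWEEN TWO SMALL BACKGROUNDS AT PRINT's OPERATOR (3.122) ON THE DIAGONAL, (117)'s FACTOR ISOLATED** — see the module header: `∃ α₀ δ₀ K > 0` (`K`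
level-free) before every binder; then for unitary `U`, `V` in the three windows, `δ`-close in bonds ∕ plaquettes ∕ level averages, ANY level maps and ANY
witnesses: (K_ι) the jet identity `∇_U → ∇_V` is bounded by `1 + w̄₁·(2|η|⁻¹·δη)·w̲₀⁻¹`; (δ_G) `‖ι(𝔊_k(U)f) − 𝔊_k(V)f‖ ≤ K·V_G·δ·‖f‖`; (δ_A)
`‖ι(H_k(U)B) − H_k(V)B‖ ≤ K·V_H·δ·‖B‖`, the (117) products `V_G`, `V_H` displayed.  The two-background energy junction read through `B11Eq117LetterDefects`
§1–§3; 0 new estimate. [folklore]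
[cite: Balaban1985Variational, (103) p.293, (110)–(111) p.294, (115) p.294, (117) p.295, (174) p.305; Balaban1985BackgroundPropagators, (3.3) p.391, Thm 3.4 p.400, (3.126) p.420, (3.153) p.426] -/
theorem exists_letter_defects_tower_pi_two_backgrounds_closed [Fact (0 < (L : ℝ))] :
    ∃ α₀ δ₀ K : ℝ, 0 < α₀ ∧ 0 < δ₀ ∧ 0 < K ∧ ∀ (n : ℕ) (η : ℝ) [Fact (0 < η)], η * (L : ℝ) ^ (n + 1) = 1 → 3 ≤ L ^ (n + 1) →
      ∀ (c₀ c₁ : ℝ) [Fact (0 < c₀)] [Fact (0 < c₁)], c₀ * ((L : ℝ) ^ (n + 1)) ^ d = c₁ → |η| ^ d / c₀ ≤ ρw →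
      ∀ (m : Fin d → ℕ) [∀ i, NeZero (m i)] (lev₀ : Bond d (towerP L m (n + 1)) → ℕ) (levB : Bond d m → ℕ)
        (lev₁ : Bond d (towerP L m (n + 1)) × Fin d → ℕ)
        (U V : Bond d (towerP L m (n + 1)) → 𝔸ˣ) (αU : ℕ → ℝ) (hα1 : ∀ j, αU j ≤ 1 / 64)
        (hU1 : ∀ (j : ℕ) (x : B7Prop1Explicit.Site d) (κ : Fin d), perCfg (towerP L m (j + 1)) (UlevOf L m (n + 1) U j) x κ ∈ U1 𝔸)
        (hreg : ∀ (j : ℕ) (y : TSite d (towerP L m j)) (κ : Fin d) (r : Fin d → Fin L),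
          ‖((Wcx L (perCfg (towerP L m (j + 1)) (UlevOf L m (n + 1) U j)) (cornerSite L y) κ (boxVec L r) : 𝔸ˣ) : 𝔸) - 1‖ ≤ αU j)
        (αV : ℕ → ℝ) (hα1' : ∀ j, αV j ≤ 1 / 64)
        (hV1 : ∀ (j : ℕ) (x : B7Prop1Explicit.Site d) (κ : Fin d), perCfg (towerP L m (j + 1)) (UlevOf L m (n + 1) V j) x κ ∈ U1 𝔸)
        (hregV : ∀ (j : ℕ) (y : TSite d (towerP L m j)) (κ : Fin d) (r : Fin d → Fin L),
          ‖((Wcx L (perCfg (towerP L m (j + 1)) (UlevOf L m (n + 1) V j)) (cornerSite L y) κ (boxVec L r) : 𝔸ˣ) : 𝔸) - 1‖ ≤ αV j),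
        (∀ j, αV j ≤ 1 / 128) →
      ∀ (εU : ℕ → ℝ), (∀ j, 0 ≤ εU j) → (∀ (j : ℕ) (b : Bond d (towerP L m (j + 1))), ‖(UlevOf L m (n + 1) U j b : 𝔸) - 1‖ ≤ εU j) →
        (∀ (j : ℕ) (b : Bond d (towerP L m (j + 1))), ‖(UlevOf L m (n + 1) V j b : 𝔸) - 1‖ ≤ εU j) →
      ∀ (δUV : ℕ → ℝ), (∀ j, 0 ≤ δUV j) →
        (∀ (j : ℕ) (b : Bond d (towerP L m (j + 1))), ‖(UlevOf L m (n + 1) U j b : 𝔸) - (UlevOf L m (n + 1) V j b : 𝔸)‖ ≤ δUV j) →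
      ∀ {α δ : ℝ}, 0 ≤ α → α ≤ α₀ → 0 ≤ δ → δ ≤ δ₀ →
        (∀ b, star (U b : 𝔸) = (((U b)⁻¹ : 𝔸ˣ) : 𝔸)) → (∀ b, star (V b : 𝔸) = (((V b)⁻¹ : 𝔸ˣ) : 𝔸)) →
        (∀ b, U b ∈ U1 𝔸) → (∀ b, V b ∈ U1 𝔸) → (∀ b, ‖(U b : 𝔸) - 1‖ ≤ α * η) → (∀ b, ‖(V b : 𝔸) - 1‖ ≤ α * η) →
        (∀ p : B9SectCLatticeCarrier.Plaq d (towerP L m (n + 1)), ‖(plaqHolU U p : 𝔸) - 1‖ ≤ α * η ^ 2) →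
        (∀ p : B9SectCLatticeCarrier.Plaq d (towerP L m (n + 1)), ‖(plaqHolU V p : 𝔸) - 1‖ ≤ α * η ^ 2) →
        (∀ b, ‖(U b : 𝔸) - (V b : 𝔸)‖ ≤ δ * η) →
        (∀ p : B9SectCLatticeCarrier.Plaq d (towerP L m (n + 1)), ‖(plaqHolU U p : 𝔸) - (plaqHolU V p : 𝔸)‖ ≤ δ * η ^ 2) →
        (∀ j < n + 1, εU j ≤ α * r ^ j) → (∀ j, δUV j ≤ δ * r ^ j) →
        ∀ (hposU' : ∀ x : SiteL2K ℂ d (towerP L m (n + 1)) c₀ W, x ≠ 0 → 0 < RCLike.re ⟪x, laplacePrimeAk L m n φ η U a' (c₁ := c₁) x⟫_ℂ)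
          (hposV' : ∀ x : SiteL2K ℂ d (towerP L m (n + 1)) c₀ W, x ≠ 0 → 0 < RCLike.re ⟪x, laplacePrimeAk L m n φ η V a' (c₁ := c₁) x⟫_ℂ)
          (hposU : ∀ x : BondL2K ℂ d (towerP L m (n + 1)) c₀ W, x ≠ 0 →
            0 < RCLike.re ⟪x, laplaceAkPi L m n φ τ η U a' hposU' hL αU hα1 hU1 hreg (c₁ := c₁) a x⟫_ℂ)
          (hposV : ∀ x : BondL2K ℂ d (towerP L m (n + 1)) c₀ W, x ≠ 0 →
            0 < RCLike.re ⟪x, laplaceAkPi L m n φ τ η V a' hposV' hL αV hα1' hV1 hregV (c₁ := c₁) a x⟫_ℂ)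
          (hQU : Function.Surjective (QkW L m n φ U hL αU hα1 hU1 hreg (c₀ := c₀) (c₁ := c₁)))
          (hQV : Function.Surjective (QkW L m n φ V hL αV hα1' hV1 hregV (c₀ := c₀) (c₁ := c₁))),
        -- (K_ι) the jet identity `∇_U → ∇_V`
        (∀ f : Space115 (L : ℝ) η lev₀ lev₁ (nabla115 η U),
          ‖LinearMap.toContinuousLinearMap
              ((jetLinearEquiv (L : ℝ) η lev₀ lev₁ (nabla115 η V)).symm.toLinearMap ∘ₗ
                (jetLinearEquiv (L : ℝ) η lev₀ lev₁ (nabla115 η U)).toLinearMap) f‖ ≤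
            (1 + (NegSup.wSup (levWeight (L : ℝ) η lev₁ 2) : ℝ) * (2 * ‖((η : ℂ))⁻¹‖ * (δ * η)) * NegSup.wInvSup (levWeight (L : ℝ) η lev₀ 1)) * ‖f‖) ∧
        -- (δ_G) the `𝔊`-letter across the two norms
        (∀ f : NegSize (L : ℝ) η lev₀ 3 𝔸,
          ‖LinearMap.toContinuousLinearMap
              ((jetLinearEquiv (L : ℝ) η lev₀ lev₁ (nabla115 η V)).symm.toLinearMap ∘ₗ
                (jetLinearEquiv (L : ℝ) η lev₀ lev₁ (nabla115 η U)).toLinearMap)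
              (frakGLatticeCLM (L := (L : ℝ)) (η := η) (lev₀ := lev₀) φ hposU hQU lev₁ (nabla115 η U) f) -
            frakGLatticeCLM (L := (L : ℝ)) (η := η) (lev₀ := lev₀) φ hposV hQV lev₁ (nabla115 η V) f‖ ≤
            K * (max (NegSup.wSup (levWeight (L : ℝ) η lev₀ 1) : ℝ) (NegSup.wSup (levWeight (L : ℝ) η lev₁ 2) * (2 * ‖((η : ℂ))⁻¹‖)) *
              (Mφ * Real.sqrt (c₀ * Fintype.card (Bond d (towerP L m (n + 1)))) * Mφ' / Real.sqrt c₀) *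
              NegSup.wInvSup (levWeight (L : ℝ) η lev₀ 3)) * δ * ‖f‖) ∧
        -- (δ_A) the `H₁`-letter across the two norms
        (∀ B : NegSize (L : ℝ) η levB 0 𝔸,
          ‖LinearMap.toContinuousLinearMap
              ((jetLinearEquiv (L : ℝ) η lev₀ lev₁ (nabla115 η V)).symm.toLinearMap ∘ₗ
                (jetLinearEquiv (L : ℝ) η lev₀ lev₁ (nabla115 η U)).toLinearMap)
              (H1LatticeCLM (L := (L : ℝ)) (η := η) (lev₀ := lev₀) (levB := levB) φ hposU hQU lev₁ (nabla115 η U) B) -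
            H1LatticeCLM (L := (L : ℝ)) (η := η) (lev₀ := lev₀) (levB := levB) φ hposV hQV lev₁ (nabla115 η V) B‖ ≤
            K * (max (NegSup.wSup (levWeight (L : ℝ) η lev₀ 1) : ℝ) (NegSup.wSup (levWeight (L : ℝ) η lev₁ 2) * (2 * ‖((η : ℂ))⁻¹‖)) *
              (Mφ * Real.sqrt (c₁ * Fintype.card (Bond d m)) * Mφ' / Real.sqrt c₀) *
              NegSup.wInvSup (levWeight (L : ℝ) η levB 0)) * δ * ‖B‖) := by
  obtain ⟨α₀, δ₀, C, hα₀, hδ₀, hC, H⟩ := exists_energy_ball_pi_two_backgrounds_closed hd L hL φ hMφ hMφ' hφ hφ' ha ha' hr0 hr1 τ hτ hCτ hρw hτ₁ hτ₂ hφτ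
  refine ⟨α₀, δ₀, C, hα₀, hδ₀, hC, ?_⟩
  intro n η _ hηL hL3 c₀ c₁ _ _ hw hρ m _ lev₀ levB lev₁ U V αU hα1 hU1 hreg αV hα1' hV1 hregV hα128 εU hεU hUε hVε δUV hδUV hLUV α δ hα0 hαle hδ0 hδle
    hUst hVst hUb hVb hUη hVη hplU hplV hUV hpp hεg hδg hposU' hposV' hposU hposV hQU hQV
  obtain ⟨-, HF, HH⟩ := H n η hηL hL3 c₀ c₁ hw hρ m U V αU hα1 hU1 hreg αV hα1' hV1 hregV hα128 εU hεU hUε hVε δUV hδUV hLUV hα0 hαle hδ0 hδle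
    hUst hVst hUb hVb hUη hVη hplU hplV hUV hpp hεg hδg hposU' hposV' hposU hposV hQU hQV
  -- the mass rows of the two Lipschitz groups
  have hG : ∀ x : BondL2K ℂ d (towerP L m (n + 1)) c₀ W, ‖frakGLatticeK hposU hQU x - frakGLatticeK hposV hQV x‖ ≤ (C * δ) * ‖x‖ :=
    fun x => (HF x).1
  have hH : ∀ b : BondL2K ℂ d m c₁ W, ‖H1LatticeK hposU hQU b - H1LatticeK hposV hQV b‖ ≤ (C * δ) * ‖b‖ := fun b => (HH b).1
  have hCδ : 0 ≤ C * δ := mul_nonneg hC.le hδ0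
  have hδη : 0 ≤ δ * η := mul_nonneg hδ0 (le_of_lt (Fact.out : 0 < η))
  -- the derivative letter at `V` and the defect of the derivative letters
  have hVb2 : ∀ b : Bond d (towerP L m (n + 1)), ‖(V b : 𝔸)‖ ≤ 1 ∧ ‖(((V b)⁻¹ : 𝔸ˣ) : 𝔸)‖ ≤ 1 := fun b => B7Prop1Explicit.mem_U1.1 (hVb b)
  have hDV : ∀ g : Bond d (towerP L m (n + 1)) → 𝔸, ‖nabla115 η V g‖ ≤ (2 * ‖((η : ℂ))⁻¹‖) * ‖g‖ := fun g => norm_nabla115_le η _ hVb2 g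
  refine ⟨fun f => ?_, fun f => ?_, fun B => ?_⟩
  · exact norm_jetId_le lev₁ (nabla115 η U) (nabla115 η V) (by positivity) (norm_nabla115_sub_le η U V hUb hVb hδη hUV) f
  · have e1 : LinearMap.toContinuousLinearMap
            ((jetLinearEquiv (L : ℝ) η lev₀ lev₁ (nabla115 η V)).symm.toLinearMap ∘ₗ
              (jetLinearEquiv (L : ℝ) η lev₀ lev₁ (nabla115 η U)).toLinearMap)
            (frakGLatticeCLM (L := (L : ℝ)) (η := η) (lev₀ := lev₀) φ hposU hQU lev₁ (nabla115 η U) f) =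
        toCLM115 (L := (L : ℝ)) (η := η) (lev₀ := lev₀) lev₁ (nabla115 η V)
          (readFun φ (fun _ => c₀) (fun _ => c₀) (frakGLatticeK hposU hQU)) f :=
      jetId_frakG_eq_toCLM115_readFun (L := (L : ℝ)) (η := η) (lev₀ := lev₀) φ lev₁ (nabla115 η U) (nabla115 η V)
        (G1LatticeK hposU) (QkW L m n φ U hL αU hα1 hU1 hreg (c₀ := c₀) (c₁ := c₁)) (KinvLatticeK hposU hQU)
        (covDerivL2K ℂ c₀ ((η : ℂ))⁻¹ (adTransportW φ U)) (RofUk L m n φ η U)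
        (covDivL2K ℂ c₀ ((η : ℂ))⁻¹ (adTransportW φ fun b => (U b)⁻¹)) f
    have e2 : frakGLatticeCLM (L := (L : ℝ)) (η := η) (lev₀ := lev₀) φ hposV hQV lev₁ (nabla115 η V) f =
        toCLM115 (L := (L : ℝ)) (η := η) (lev₀ := lev₀) lev₁ (nabla115 η V)
          (readFun φ (fun _ => c₀) (fun _ => c₀) (frakGLatticeK hposV hQV)) f :=
      frakG_eq_toCLM115_readFun (L := (L : ℝ)) (η := η) (lev₀ := lev₀) φ lev₁ (nabla115 η V)
        (G1LatticeK hposV) (QkW L m n φ V hL αV hα1' hV1 hregV (c₀ := c₀) (c₁ := c₁)) (KinvLatticeK hposV hQV)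
        (covDerivL2K ℂ c₀ ((η : ℂ))⁻¹ (adTransportW φ V)) (RofUk L m n φ η V)
        (covDivL2K ℂ c₀ ((η : ℂ))⁻¹ (adTransportW φ fun b => (V b)⁻¹)) f
    rw [e1, e2]
    have h := norm_toCLM115_readFun_sub_le (L := (L : ℝ)) (η := η) (lev₀ := lev₀) φ hMφ hφ hMφ' hφ' lev₁ (nabla115 η V)
      (frakGLatticeK hposU hQU) (frakGLatticeK hposV hQV) hCδ hG hDV f
    exact le_of_le_of_eq h (by ring)
  · have e1 : LinearMap.toContinuousLinearMap
            ((jetLinearEquiv (L : ℝ) η lev₀ lev₁ (nabla115 η V)).symm.toLinearMap ∘ₗ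
              (jetLinearEquiv (L : ℝ) η lev₀ lev₁ (nabla115 η U)).toLinearMap)
            (H1LatticeCLM (L := (L : ℝ)) (η := η) (lev₀ := lev₀) (levB := levB) φ hposU hQU lev₁ (nabla115 η U) B) =
        H1CLM (L := (L : ℝ)) (η := η) (lev₀ := lev₀) (levB := levB) φ lev₁ (nabla115 η V) (H1LatticeK hposU hQU) B := rfl
    have e2 : H1LatticeCLM (L := (L : ℝ)) (η := η) (lev₀ := lev₀) (levB := levB) φ hposV hQV lev₁ (nabla115 η V) B =
        H1CLM (L := (L : ℝ)) (η := η) (lev₀ := lev₀) (levB := levB) φ lev₁ (nabla115 η V) (H1LatticeK hposV hQV) B := rfl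
    rw [e1, e2]
    have h := norm_H1CLM_sub_le (L := (L : ℝ)) (η := η) (lev₀ := lev₀) (levB := levB) φ hMφ hφ hMφ' hφ' lev₁ (nabla115 η V)
      (H1LatticeK hposU hQU) (H1LatticeK hposV hQV) hCδ hH hDV B
    exact le_of_le_of_eq h (by ring)

end Literature.MathematicalPhysics.QuantumFieldTheory.Balaban1983to89.B11Eq117LetterDefectsTowerPiTwoBackgrounds

end
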